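import Mathlib
import Summits.Ventures.PercRepro2.Defs
import Summits.Ventures.PercRepro2.Graph
import Summits.Ventures.PercRepro2.Harris
import Summits.Ventures.PercRepro2.Events
import Summits.Ventures.PercRepro2.Independence
import Summits.Ventures.PercRepro2.Induced
import Summits.Ventures.PercRepro2.Exploration
import Summits.Ventures.PercRepro2.GateDefs
import Summits.Ventures.PercRepro2.GateAnatomy
import Summits.Ventures.PercRepro2.GateForest
import Summits.Ventures.PercRepro2.GateLSM
import Summits.Ventures.PercRepro2.HullTree
import Summits.Ventures.PercRepro2.GateFeedbackForest
import Summits.Ventures.PercRepro2.GateFeedback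
import Summits.Ventures.PercRepro2.GateFeedbackExit
import Summits.Ventures.PercRepro2.GateContract
import Summits.Ventures.PercRepro2.GateShadow

/-!
# Sides of a cut vertex and connections through a separator (blind cell PercRepro2, mine-c g10;
proofs/MINEC-FEEDBACK.md §11, Lemma 11.2)

`side ends z x` is the set of vertices reachable from `x` in `G − z`. A connection `x ↔ z` is
decided by the edges touching the side of `x` (`dependsOn_conn_side`); the edge sets of two
different sides are disjoint (`disjoint_touches_side`); a separator splits a connection in `G ∖ W`
(`mem_connDelEvent_iff_of_sep`); and the two halves are independent
(`prob_connDelEvent_inter_connEvent_of_sep`). Used by `GateSep` for the separator reductions.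
-/



namespace Summit.Ventures.PercRepro2

namespace GateSide

open scoped Classical

variable {V : Type*} {E : Type*} [Fintype E] [Fintype V]
variable {R : Type*} [Field R] [LinearOrder R] [IsStrictOrderedRing R]

/-! ## Sides of a vertex -/

section Side

variable {ends : E → Sym2 V}

omit [Fintype E] [Fintype V] in
/-- The side of `x` at `z`: the vertices reachable from `x` in `G − z`. -/
def side (ends : E → Sym2 V) (z x : V) : Set V :=
  {v | Conn (GateContract.endsDel ends {z}) (fun _ => true) x v}

omit [Fintype E] [Fintype V] in
/-- `x` is on its own side. -/
lemma mem_side_self (z x : V) : x ∈ side ends z x := conn_refl _ _ _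

omit [Fintype E] [Fintype V] in
/-- Sides are transitive. -/
lemma mem_side_trans {z x v v' : V} (h : v ∈ side ends z x) (h' : v' ∈ side ends z v) :
    v' ∈ side ends z x := conn_trans h h'

omit [Fintype E] [Fintype V] in
/-- Sides are symmetric. -/
lemma mem_side_symm {z x v : V} (h : v ∈ side ends z x) : x ∈ side ends z v := conn_symm h

omit [Fintype E] [Fintype V] in
/-- `z` is isolated in `G − z`: it is on nobody's side but its own. -/
lemma not_mem_side {z x : V} (hxz : x ≠ z) : z ∉ side ends z x := fun h =>
  hxz (GateContract.eq_of_conn_of_isolated (fun e => e.2 z (Finset.mem_singleton_self z)) h)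

omit [Fintype E] [Fintype V] in
/-- An edge of `G` from the side of `x` leads to the side of `x` or to `z`. -/
lemma mem_side_of_openAdj {z x v v' : V} (hxz : x ≠ z) (hv : v ∈ side ends z x) {ω : Config E}
    (hadj : OpenAdj ends ω v v') (hv'z : v' ≠ z) : v' ∈ side ends z x := by
  obtain ⟨e, _, hends⟩ := hadj
  have hvz : v ≠ z := fun h => not_mem_side hxz (h ▸ hv)
  have he : ∀ t ∈ ({z} : Finset V), t ∉ ends e := by
    intro t ht hmem
    rw [Finset.mem_singleton] at ht
    subst ht
    rw [hends, Sym2.mem_iff] at hmem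
    rcases hmem with h | h
    · exact hvz h.symm
    · exact hv'z h.symm
  exact mem_side_trans hv (conn_of_openAdj ⟨⟨e, he⟩, rfl, hends⟩)

omit [Fintype E] [Fintype V] in
/-- **A connection from `x` to `z` is decided by the edges touching the side of `x`.** -/
lemma conn_of_conn_of_eqOn_side {z x : V} (hxz : x ≠ z) {ω ω' : Config E}
    (h : ∀ e ∈ touches ends (side ends z x), ω e = ω' e) (hc : Conn ends ω x z) :
    Conn ends ω' x z := by
  let S : Set V := {v | (v ∈ side ends z x ∧ Conn ends ω' x v) ∨ Conn ends ω' x z}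
  have hS : ∀ v ∈ S, ∀ v', (openGraph ends ω).Adj v v' → v' ∈ S := by
    intro v hv v' hadj
    rcases hv with ⟨hvs, hcv⟩ | hz
    · obtain ⟨_, e, he, hends⟩ := openGraph_adj.1 hadj
      have hetouch : e ∈ touches ends (side ends z x) := ⟨v, hvs, v', hends⟩
      have he' : ω' e = true := by rw [← h e hetouch]; exact he
      have hcv' : Conn ends ω' x v' := conn_trans hcv (conn_of_openAdj ⟨e, he', hends⟩)
      by_cases hv'z : v' = z
      · exact Or.inr (hv'z ▸ hcv')
      · exact Or.inl ⟨mem_side_of_openAdj hxz hvs ⟨e, he, hends⟩ hv'z, hcv'⟩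
    · exact Or.inr hz
  have hz : z ∈ S := mem_of_conn_of_closed hS (Or.inl ⟨mem_side_self z x, conn_refl _ _ _⟩) hc
  rcases hz with ⟨hzs, _⟩ | hz
  · exact (not_mem_side hxz hzs).elim
  · exact hz

omit [Fintype E] [Fintype V] in
/-- `{x ↔ z}` depends only on the edges touching the side of `x`. -/
lemma dependsOn_conn_side (z x : V) :
    DependsOn (fun ω : Config E => Conn ends ω x z) (touches ends (side ends z x)) := by
  intro ω ω' h
  by_cases hxz : x = z
  · subst hxz
    exact propext ⟨fun _ => conn_refl _ _ _, fun _ => conn_refl _ _ _⟩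
  · exact propext ⟨conn_of_conn_of_eqOn_side hxz h,
      conn_of_conn_of_eqOn_side hxz fun e he => (h e he).symm⟩

omit [Fintype E] [Fintype V] in
/-- The edges touching two different sides are disjoint. -/
lemma disjoint_touches_side {z x y : V} (hxz : x ≠ z) (hyz : y ≠ z) (hsep : y ∉ side ends z x) :
    Disjoint (touches ends (side ends z x)) (touches ends (side ends z y)) := by
  rw [Set.disjoint_left]
  rintro e ⟨a, ha, b, hab⟩ ⟨a', ha', b', hab'⟩
  -- `a' ∈ {a, b}`; `{a, b} ⊆ side x ∪ {z}`
  have hb : b ∈ side ends z x ∨ b = z := by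
    by_cases hbz : b = z
    · exact Or.inr hbz
    · exact Or.inl (mem_side_of_openAdj hxz ha (ω := fun _ => true) ⟨e, rfl, hab⟩ hbz)
  have hmem : a' = a ∨ a' = b := by
    have : a' ∈ ends e := by rw [hab']; exact Sym2.mem_mk_left _ _
    rw [hab, Sym2.mem_iff] at this
    exact this
  have key : ∀ v, v ∈ side ends z x ∨ v = z → v ∈ side ends z y → False := by
    rintro v (hv | rfl) hv'
    · exact hsep (mem_side_trans hv (mem_side_symm hv'))
    · exact not_mem_side hyz hv'
  rcases hmem with h | h
  · rw [h] at ha'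
    exact key a (Or.inl ha) ha'
  · rw [h] at ha'
    exact key b hb ha'

omit [Fintype E] [Fintype V] in
/-- An edge touching the side of `y` has both ends in `side y ∪ {z}`. -/
lemma ends_subset_of_mem_touches_side {z y : V} (hyz : y ≠ z) {e : E}
    (he : e ∈ touches ends (side ends z y)) {v : V} (hv : v ∈ ends e) :
    v ∈ side ends z y ∨ v = z := by
  obtain ⟨a, ha, b, hab⟩ := he
  rw [hab, Sym2.mem_iff] at hv
  rcases hv with rfl | rfl
  · exact Or.inl ha
  · by_cases hbz : v = z
    · exact Or.inr hbz
    · exact Or.inl (mem_side_of_openAdj hyz ha (ω := fun _ => true) ⟨e, rfl, hab⟩ hbz)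

end Side

/-! ## Connections in `G ∖ W` through a separator -/

section Split

variable {ends : E → Sym2 V}

omit [Fintype E] in
/-- **The separator splits the connection**: if every `x–y` path passes through `z`, then
`x ↔ y in G ∖ W ↔ (x ↔ z in G ∖ W) ∧ (z ↔ y in G ∖ W)`. -/
lemma mem_connDelEvent_iff_of_sep {z x y : V} (hsep : y ∉ side ends z x) (W : Finset V)
    {ω : Config E} :
    ω ∈ connDelEvent ends W x y ↔
      ω ∈ connDelEvent ends W x z ∧ ω ∈ connDelEvent ends W z y := by
  simp only [mem_connDelEvent]
  constructor
  · intro h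
    obtain ⟨t, ht, hxz⟩ := GateShadow.exists_conn_mem_of_not_reachDel (T := {z}) h hsep
    rw [Finset.mem_singleton] at ht
    subst ht
    exact ⟨hxz, conn_trans (conn_symm hxz) h⟩
  · rintro ⟨h₁, h₂⟩
    exact conn_trans h₁ h₂

omit [Fintype E] in
/-- If `W` does not meet the side of `y` (and `z ∉ W`), `{z ↔ y in G ∖ W} = {z ↔ y}`. -/
lemma connDelEvent_eq_connEvent_of_side {z y : V} (hyz : y ≠ z) {W : Finset V} (hz : z ∉ W)
    (hW : ∀ v ∈ W, v ∉ side ends z y) :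
    connDelEvent ends W z y = connEvent ends z y := by
  ext ω
  simp only [mem_connDelEvent, connEvent, Set.mem_setOf_eq]
  have hagree : ∀ e ∈ touches ends (side ends z y),
      restrict (touches ends (↑W : Set V))ᶜ ω e = ω e := by
    intro e he
    have hnot : e ∉ touches ends (↑W : Set V) := by
      rintro ⟨v, hv, b, hvb⟩
      have hmem : v ∈ ends e := by rw [hvb]; exact Sym2.mem_mk_left _ _
      rcases ends_subset_of_mem_touches_side hyz he hmem with h | rfl
      · exact hW v (Finset.mem_coe.1 hv) h
      · exact hz (Finset.mem_coe.1 hv)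
    exact restrict_apply_of_mem hnot
  have hd := dependsOn_conn_side (ends := ends) z y
  constructor
  · intro h
    exact conn_symm (Iff.of_eq (hd hagree) |>.1 (conn_symm h))
  · intro h
    exact conn_symm (Iff.of_eq (hd fun e he => (hagree e he).symm) |>.1 (conn_symm h))

omit [Fintype E] in
/-- `{x ↔ z in G ∖ W}` depends only on the edges touching the side of `x`. -/
lemma dependsOn_connDelEvent_side (W : Finset V) (z x : V) :
    DependsOn (· ∈ connDelEvent ends W x z) (touches ends (side ends z x)) := by
  intro ω ω' h
  simp only [mem_connDelEvent]
  have h' : ∀ e ∈ touches ends (side ends z x),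
      restrict (touches ends (↑W : Set V))ᶜ ω e = restrict (touches ends (↑W : Set V))ᶜ ω' e := by
    intro e he
    simp only [restrict, h e he]
  exact dependsOn_conn_side (ends := ends) z x h'

omit [Fintype E] [Fintype V] in
/-- `{z ↔ y}` depends only on the edges touching the side of `y`. -/
lemma dependsOn_connEvent_side (z y : V) :
    DependsOn (· ∈ connEvent ends z y) (touches ends (side ends z y)) := by
  intro ω ω' h
  simp only [connEvent, Set.mem_setOf_eq]
  have := dependsOn_conn_side (ends := ends) z y h
  exact propext ⟨fun hc => conn_symm (Iff.of_eq this |>.1 (conn_symm hc)),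
    fun hc => conn_symm (Iff.of_eq this |>.2 (conn_symm hc))⟩

omit [LinearOrder R] [IsStrictOrderedRing R] in
/-- **Independence across the separator**: `P(x ↔ z in G ∖ W, z ↔ y) = P(x ↔ z in G ∖ W) · P(z ↔ y)`
when `z` separates `x` from `y`. -/
lemma prob_connDelEvent_inter_connEvent_of_sep (p : E → R) {z x y : V} (hxz : x ≠ z) (hyz : y ≠ z)
    (hsep : y ∉ side ends z x) (W : Finset V) :
    prob p (connDelEvent ends W x z ∩ connEvent ends z y) =
      prob p (connDelEvent ends W x z) * prob p (connEvent ends z y) :=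
  prob_inter_eq_mul_of_dependsOn p (disjoint_touches_side hxz hyz hsep)
    (dependsOn_connDelEvent_side W z x) (dependsOn_connEvent_side z y)

end Split


end GateSide

end Summit.Ventures.PercRepro2
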